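import Summits.Ventures.PercRepro.C025Profile

/-!
# PercRepro — C-032 PROFILE (Π): loops halve both sides (night-3, gen 6)

The loop step of any induction on `(Π_{q,u})` (NIGHT3-G6-PROFILE.md §1, §7(d)): for a loop `ℓ` of a finite matroid `M`,
the rank-`u` level of `M` is twice that of `M ＼ {ℓ}` (`card_levelSet_of_isLoop`: `S ↦ S.erase ℓ` on the sets containing
`ℓ`, a loop not changing the rank, `eRk_insert_of_isLoop`), and the rank-`q` sets of `M` pay twice what those of `M ＼ {ℓ}`
pay (`sum_price_of_isLoop`: the price of `B` depends on `ρ(E ∖ B)`, unchanged by the loop — `price_delete_of_isLoop_notMem`,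
`price_delete_of_isLoop_mem`). Hence **`profileIneq_of_delete_isLoop`**: `(Π_{q,u})` on `M ＼ {ℓ}` gives `(Π_{q,u})` on `M`,
for every `q`, `u`. A SUPPORT of S5 (CRUX-SUBCLAIMS): with it the row reduces to loopless matroids.
-/

open scoped Matroid

namespace PercRepro

open Set Finset ThmH

section ProfileLoop

variable {α : Type*} [DecidableEq α] {M : Matroid α} [M.Finite]

omit [DecidableEq α] [M.Finite] in
/-- Adding a loop does not change the rank. -/
theorem eRk_insert_of_isLoop {ℓ : α} (hℓ : M.IsLoop ℓ) (X : Set α) : M.eRk (insert ℓ X) = M.eRk X := by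
  rw [← M.eRk_insert_closure_eq, Set.insert_eq_of_mem (hℓ.mem_closure X), M.eRk_closure_eq]

omit [DecidableEq α] in
/-- Ranks in `M ＼ {ℓ}` of subsets avoiding `ℓ` are ranks in `M`. -/
theorem eRk_delete_of_notMem {ℓ : α} {S : Finset α} (hS : S ⊆ gr M) (hℓ : ℓ ∉ S) :
    (M ＼ ({ℓ} : Set α)).eRk (S : Set α) = M.eRk (S : Set α) := by
  rw [Matroid.delete_eq_restrict, Matroid.restrict_eRk_eq]
  intro x hx
  refine ⟨by rw [← coe_gr]; exact_mod_cast hS hx, ?_⟩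
  rw [Set.mem_singleton_iff]; rintro rfl; exact hℓ hx

omit [M.Finite] in
/-- The ground finset of `M ＼ {e}`. -/
theorem gr_delete_singleton' [M.Finite] (e : α) : gr (M ＼ ({e} : Set α)) = (gr M).erase e := by
  apply Finset.coe_injective
  rw [coe_gr, Finset.coe_erase, coe_gr, Matroid.delete_ground]

/-- The level of `M` at a loop `ℓ` is twice the level of `M ＼ {ℓ}`. -/
theorem card_levelSet_of_isLoop {ℓ : α} (hℓ : M.IsLoop ℓ) (u : ℕ) :
    (Shadow.levelSet M u).card = 2 * (Shadow.levelSet (M ＼ ({ℓ} : Set α)) u).card := by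
  classical
  have hℓE : ℓ ∈ gr M := by rw [← Finset.mem_coe, coe_gr]; exact hℓ.mem_ground
  rw [← Finset.card_filter_add_card_filter_not (s := Shadow.levelSet M u) (fun S => ℓ ∈ S), two_mul, add_comm]
  congr 1
  · -- sets avoiding ℓ
    congr 1
    ext S
    simp only [Finset.mem_filter, Profile.mem_levelSet, gr_delete_singleton']
    constructor
    · rintro ⟨⟨hS, hr⟩, hℓS⟩
      refine ⟨fun x hx => Finset.mem_erase.2 ⟨fun h => hℓS (h ▸ hx), hS hx⟩, ?_⟩
      rw [eRk_delete_of_notMem hS hℓS]; exact hr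
    · rintro ⟨hS, hr⟩
      have hℓS : ℓ ∉ S := fun h => (Finset.mem_erase.1 (hS h)).1 rfl
      have hS' : S ⊆ gr M := hS.trans (Finset.erase_subset _ _)
      refine ⟨⟨hS', ?_⟩, hℓS⟩
      rw [← eRk_delete_of_notMem hS' hℓS]; exact hr
  · -- sets containing ℓ ↔ (erase ℓ) sets of the same rank
    rw [← Finset.card_image_of_injOn (f := fun S => S.erase ℓ)]
    · congr 1
      ext S'
      simp only [Finset.mem_image, Finset.mem_filter, Profile.mem_levelSet, gr_delete_singleton']
      constructor
      · rintro ⟨S, ⟨⟨hS, hr⟩, hℓS⟩, rfl⟩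
        refine ⟨fun x hx => ?_, ?_⟩
        · rw [Finset.mem_erase] at hx ⊢; exact ⟨hx.1, hS hx.2⟩
        · have hsub : S.erase ℓ ⊆ gr M := (Finset.erase_subset _ _).trans hS
          have hne : ℓ ∉ S.erase ℓ := Finset.notMem_erase ℓ S
          rw [eRk_delete_of_notMem hsub hne]
          have h1 : S = insert ℓ (S.erase ℓ) := (Finset.insert_erase hℓS).symm
          rw [h1, Finset.coe_insert, eRk_insert_of_isLoop hℓ] at hr
          exact hr
      · rintro ⟨hS', hr⟩
        have hℓS' : ℓ ∉ S' := fun h => (Finset.mem_erase.1 (hS' h)).1 rfl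
        have hS'g : S' ⊆ gr M := hS'.trans (Finset.erase_subset _ _)
        refine ⟨insert ℓ S', ⟨⟨Finset.insert_subset hℓE hS'g, ?_⟩, Finset.mem_insert_self _ _⟩,
          Finset.erase_insert hℓS'⟩
        rw [Finset.coe_insert, eRk_insert_of_isLoop hℓ, ← eRk_delete_of_notMem hS'g hℓS', hr]
    · intro S hS S₂ hS₂ h
      simp only [Finset.coe_filter, Profile.mem_levelSet] at hS hS₂
      simp only at h
      rw [← Finset.insert_erase hS.2, ← Finset.insert_erase hS₂.2, h]

/-- For `B ⊆ gr M` avoiding the loop `ℓ`, the price in `M` equals the price in `M ＼ {ℓ}`. -/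
theorem price_delete_of_isLoop_notMem {ℓ : α} (hℓ : M.IsLoop ℓ) (q u : ℕ) {B : Finset α} (hℓB : ℓ ∉ B) :
    Profile.price M q u B = Profile.price (M ＼ ({ℓ} : Set α)) q u B := by
  have hℓE : ℓ ∈ gr M := by rw [← Finset.mem_coe, coe_gr]; exact hℓ.mem_ground
  have hkey : M.eRk ((gr M \ B : Finset α) : Set α) =
      (M ＼ ({ℓ} : Set α)).eRk ((gr (M ＼ ({ℓ} : Set α)) \ B : Finset α) : Set α) := by
    rw [gr_delete_singleton']
    have h1 : gr M \ B = insert ℓ ((gr M).erase ℓ \ B) := by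
      ext x
      simp only [Finset.mem_sdiff, Finset.mem_insert, Finset.mem_erase]
      constructor
      · rintro ⟨hx, hxB⟩
        by_cases hxℓ : x = ℓ
        · exact Or.inl hxℓ
        · exact Or.inr ⟨⟨hxℓ, hx⟩, hxB⟩
      · rintro (rfl | ⟨⟨_, hx⟩, hxB⟩)
        · exact ⟨hℓE, hℓB⟩
        · exact ⟨hx, hxB⟩
    have hsub : (gr M).erase ℓ \ B ⊆ gr M := Finset.sdiff_subset.trans (Finset.erase_subset _ _)
    have hne : ℓ ∉ (gr M).erase ℓ \ B := fun h => (Finset.mem_erase.1 (Finset.mem_sdiff.1 h).1).1 rfl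
    rw [h1, Finset.coe_insert, eRk_insert_of_isLoop hℓ, eRk_delete_of_notMem hsub hne]
  unfold Profile.price
  rw [hkey]

/-- For `B ∋ ℓ` (a loop), the price in `M` equals the price of `B.erase ℓ` in `M ＼ {ℓ}`. -/
theorem price_delete_of_isLoop_mem {ℓ : α} (q u : ℕ) {B : Finset α} (hℓB : ℓ ∈ B) :
    Profile.price M q u B = Profile.price (M ＼ ({ℓ} : Set α)) q u (B.erase ℓ) := by
  have hkey : M.eRk ((gr M \ B : Finset α) : Set α) =
      (M ＼ ({ℓ} : Set α)).eRk ((gr (M ＼ ({ℓ} : Set α)) \ B.erase ℓ : Finset α) : Set α) := by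
    rw [gr_delete_singleton']
    have h1 : (gr M).erase ℓ \ B.erase ℓ = gr M \ B := by
      ext x
      simp only [Finset.mem_sdiff, Finset.mem_erase, not_and]
      constructor
      · rintro ⟨⟨hxℓ, hx⟩, h⟩
        exact ⟨hx, fun hxB => h hxℓ hxB⟩
      · rintro ⟨hx, hxB⟩
        have hxℓ : x ≠ ℓ := fun h => hxB (h ▸ hℓB)
        exact ⟨⟨hxℓ, hx⟩, fun _ hxB' => hxB hxB'⟩
    have hsub : gr M \ B ⊆ gr M := Finset.sdiff_subset
    have hne : ℓ ∉ gr M \ B := fun h => (Finset.mem_sdiff.1 h).2 hℓB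
    rw [h1, eRk_delete_of_notMem hsub hne]
  unfold Profile.price
  rw [hkey]

/-- The rank-`q` sets of `M` at a loop `ℓ` pay twice what those of `M ＼ {ℓ}` pay. -/
theorem sum_price_of_isLoop {ℓ : α} (hℓ : M.IsLoop ℓ) (q u : ℕ) :
    ∑ B ∈ Profile.Rq M q, Profile.price M q u B =
      2 * ∑ B ∈ Profile.Rq (M ＼ ({ℓ} : Set α)) q, Profile.price (M ＼ ({ℓ} : Set α)) q u B := by
  classical
  have hℓE : ℓ ∈ gr M := by rw [← Finset.mem_coe, coe_gr]; exact hℓ.mem_ground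
  rw [← Finset.sum_filter_add_sum_filter_not (Profile.Rq M q) (fun B => ℓ ∈ B), two_mul, add_comm]
  congr 1
  · -- B avoiding ℓ
    have h1 : (Profile.Rq M q).filter (fun B => ¬ ℓ ∈ B) = Profile.Rq (M ＼ ({ℓ} : Set α)) q := by
      ext B
      simp only [Finset.mem_filter, Profile.mem_Rq, gr_delete_singleton']
      constructor
      · rintro ⟨⟨hB, hr⟩, hℓB⟩
        refine ⟨fun x hx => Finset.mem_erase.2 ⟨fun h => hℓB (h ▸ hx), hB hx⟩, ?_⟩
        rw [eRk_delete_of_notMem hB hℓB]; exact hr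
      · rintro ⟨hB, hr⟩
        have hℓB : ℓ ∉ B := fun h => (Finset.mem_erase.1 (hB h)).1 rfl
        have hB' : B ⊆ gr M := hB.trans (Finset.erase_subset _ _)
        refine ⟨⟨hB', ?_⟩, hℓB⟩
        rw [← eRk_delete_of_notMem hB' hℓB]; exact hr
    rw [h1]
    apply Finset.sum_congr rfl
    intro B hB
    rw [Profile.mem_Rq, gr_delete_singleton'] at hB
    have hℓB : ℓ ∉ B := fun h => (Finset.mem_erase.1 (hB.1 h)).1 rfl
    exact price_delete_of_isLoop_notMem hℓ q u hℓB
  · -- B containing ℓ: reindex by erase ℓ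
    have h2 : ((Profile.Rq M q).filter (fun B => ℓ ∈ B)).image (fun B => B.erase ℓ) = Profile.Rq (M ＼ ({ℓ} : Set α)) q := by
      ext B'
      simp only [Finset.mem_image, Finset.mem_filter, Profile.mem_Rq, gr_delete_singleton']
      constructor
      · rintro ⟨B, ⟨⟨hB, hr⟩, hℓB⟩, rfl⟩
        refine ⟨fun x hx => ?_, ?_⟩
        · rw [Finset.mem_erase] at hx ⊢; exact ⟨hx.1, hB hx.2⟩
        · have hsub : B.erase ℓ ⊆ gr M := (Finset.erase_subset _ _).trans hB
          have hne : ℓ ∉ B.erase ℓ := Finset.notMem_erase ℓ B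
          rw [eRk_delete_of_notMem hsub hne]
          have h1 : B = insert ℓ (B.erase ℓ) := (Finset.insert_erase hℓB).symm
          rw [h1, Finset.coe_insert, eRk_insert_of_isLoop hℓ] at hr
          exact hr
      · rintro ⟨hB', hr⟩
        have hℓB' : ℓ ∉ B' := fun h => (Finset.mem_erase.1 (hB' h)).1 rfl
        have hB'g : B' ⊆ gr M := hB'.trans (Finset.erase_subset _ _)
        refine ⟨insert ℓ B', ⟨⟨Finset.insert_subset hℓE hB'g, ?_⟩, Finset.mem_insert_self _ _⟩, Finset.erase_insert hℓB'⟩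
        rw [Finset.coe_insert, eRk_insert_of_isLoop hℓ, ← eRk_delete_of_notMem hB'g hℓB', hr]
    have hinj : Set.InjOn (fun B : Finset α => B.erase ℓ) ((Profile.Rq M q).filter (fun B => ℓ ∈ B)) := by
      intro S hS S₂ hS₂ h
      simp only [Finset.coe_filter] at hS hS₂
      simp only at h
      rw [← Finset.insert_erase hS.2, ← Finset.insert_erase hS₂.2, h]
    rw [← h2, Finset.sum_image hinj]
    apply Finset.sum_congr rfl
    intro B hB
    exact price_delete_of_isLoop_mem q u (Finset.mem_filter.1 hB).2

/-- **Loops halve both sides**: `(Π_{q,u})` on `M ＼ {ℓ}` gives `(Π_{q,u})` on `M` for a loop `ℓ` (and conversely). -/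
theorem profileIneq_of_delete_isLoop {ℓ : α} (hℓ : M.IsLoop ℓ) {q u : ℕ}
    (h : Profile.ProfileIneq (M ＼ ({ℓ} : Set α)) q u) : Profile.ProfileIneq M q u := by
  unfold Profile.ProfileIneq at h ⊢
  rw [sum_price_of_isLoop hℓ q u, card_levelSet_of_isLoop hℓ u]
  push_cast
  linarith

end ProfileLoop

end PercRepro
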